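import Mathlib
import HarnessLib
import HarnessLib.Audit
import Summits.AtomisticToContinuum.Statement
import Summits.AtomisticToContinuum.Crystallization.Theorems.PricedLinkCensusCrysEnergyUpper
import HarnessLib.Audit.Status.Attr

/-!
Route: ZeroPressureMagicFunction

DORMANT since 2026-08-22T23:23:36Z (reconciler: no traction for 5.7 d (last activity item-evidence-added at 2026-08-17T04:47:41Z); parked, not closed — `ledger route dormant route-AtomisticToContinuum-ZeroPressureMagicFunction --off` to) — unstaffed, not closed; items shared with open routes are served there. `ledger route dormant <id> --off` reactivates.

# Route ZeroPressureMagicFunction — a zero-pressure magic function for Lennard-Jones decides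
crystallization; ladder d=1, 8, 3

It suffices to show X = X₃ ∧ R₃ for V = V_LJ = r⁻¹²/12 − r⁻⁶/6 in ℝ³ (card
zero-pressure-magic-function-dimension-ladder; conforming successor, D-0027 §2.1, of the retired
route ZeroPressureMagicLadder, whose vetted signatures are re-filed). X₃ = MagicFunctionLJ3
(ZERO-PRESSURE MAGIC FUNCTION): a continuous positive-definite g on ℝ³ with g ≤ V(|x|) off 0 whose
Fisher–Ruelle / Cohn–Kumar value −g(0)/2 — a lower bound for E(N)/N for every N and for e(Q) of
every periodic Q, with no density term because free clusters sit at zero pressure — is ATTAINED by a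
periodic configuration P. R₃ = CertificateRigidity3: a tight certificate pins pair distances to {g =
V} and the structure factor to {ĝ = 0} and thereby forces local convergence of ground states to a
periodic point measure. Given X₃ the energetic conjunct is bookkeeping (support
CertificateEnergetics3 over the classical bounds FiniteBochnerBound3, PeriodicBochnerBound3,
CrysEnergyUpper and the proved thermodynamic limit BlancLewin2015_8_holds); given R₃ the positional
conjunct follows; `closes` is three lines of logic. The ladder rungs LineLitmus (d = 1, numerically
sharp) and E8Rung (d = 8, CKMRV basis) are ranked cruxes that test the engine where the answer is
decidable; they are hypotheses of `closes` it does not use.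
Lean: `MagicFunctionLJ3 ∧ CertificateRigidity3`

## Assembly
Pure logic (sorry-free in Sketch.lean, axioms propext / Classical.choice / Quot.sound): `theorem
closes (h₁ : MagicFunctionLJ3) (h₂ : LineLitmus) (h₃ : CertificateRigidity3) (h₄ : E8Rung) (h₅ :
FiniteBochnerBound3) (h₆ : PeriodicBochnerBound3) (h₇ : CrysEnergyUpper) (h₈ :
CertificateEnergetics3) : _root_.Crystallization` — destructure h₁ into (g, P, tightness); the
energetic conjunct is h₈ h₅ h₆ h₇ h₁, the positional conjunct is h₃ g P applied to the certificate;
the pair is Crystallization (an `abbrev` of the Literature conjunction). LineLitmus and E8Rung are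
hypotheses `closes` does not use (ladder rungs: kill/steer). The `Assembly` item is kept minimal
(schema: one assembly item at open; it is the load-bearing chain without the rungs and is proved by
the same three lines); `closes` is the deciding theorem (D-0027 §2.1).

Rationale: WHY THIS LINE. The two-point Fourier bound is the only device that has ever proved energy
minimisation among ALL
periodic configurations in d ≥ 2 (CohnEtAl2019 Thm 1.4, d = 8, 24, completely monotone potentials at
FIXED density; Viazovska2017), and its zero-pressure form Σ_{i<j} V(xᵢ−xⱼ) ≥ −N g(0)/2 (Ruelle1969
Prop. 3.2.7, CohnKumar2006 §9 Prop. 9.3) has exactly the shape of conjunct (i): with the proved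
facts lennardJones_stable_holds / BlancLewin2015_8_holds and the periodisation remark (a ground
state repeated with period ≥ diam + 1 is a periodic competitor of no larger energy per particle, V ≤
0 beyond 1) conjunct (i) IS attainment of inf_Q e(Q), which a tight certificate delivers together
with the minimiser's pair statistics. For a DIFFERENCE of completely monotone functions nothing
transfers from CKMRV, but the interpolation constructions are linear in the potential and at the
equilibrium scale the stationarity Σ_k k·V′(ak) = 0 makes the candidate automatically tight (∫g =
ĝ(0) = 0), so sharpness is two sign checks on one explicit function: the retired predecessor ran
them in d = 1 (Cohn–Kumar band-limited Hermite interpolant of V(a*·)) and found the bound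
numerically SHARP (margins in § Numbers) — new evidence that pair positivity does see Lennard-Jones
crystallization on the line, where Ventevogel–Nijboer / Gardner–Radin give the primal answer.
Imported areas: Fourier/LP duality and modular-form interpolation (sphere packing), Fisher–Ruelle
stability (statistical mechanics), crystalline- measure rigidity (Lev–Olevskii) for R₃. Versus the
negatives index (EffectiveLocalHales@1/100, OneGrainGluing): no contact — no local-geometry
classification is used. Versus open routes: none uses a dual certificate (checked:
BrittleRungDescent, Chessboard, HcpTheta, LuttingerTisza, PoissonBessel, PalmUnimodular,
SymmetryRank, ExcessDecayLiouville, HolmgrenBoyleLind).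

RANKED CRUXES. #2 MagicFunctionLJ3 (crux) — X₃ — there is a continuous positive-definite g : ℝ³ → ℝ
(all finite real quadratic forms Σ cᵢcⱼ g(xᵢ − xⱼ) ≥ 0) with g(x) ≤ V_LJ(|x|) for x ≠ 0 whose
zero-pressure bound −g(0)/2 is attained by a periodic configuration P (card M-assembly; expected P =
relaxed hcp, e(P) = −L₆²/(24L₁₂) ≈ −0.7176; re-files item 3955). [difficulty: open-problem] (why it
might fail: Two-point LPs are not sharp in d=3 for packing (Li2022: 0.18398 > 0.17678) nor kissing
(LP 13.16 > 12): a PD phantom pair measure with ~13 'neighbours' in the well may beat hcp's 12; one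
Li-type Dirac comb with ½∫V dν < e(hcp) refutes it (kit j003580/j003583 running).) [Li2022,
CohnKumar2006, CohnLaatSalmon2022, Ruelle1969, Yuhjtman2015, DelimaProcacciYuhjtman2015,
BlancLewin2015, doi:10.1007/s10955-007-9393-y]
#3 LineLitmus (crux) — d = 1 LITMUS (card M2; re-files item 3956): the zero-pressure two-point bound
is sharp for the Lennard-Jones chain — a continuous positive-definite g : ℝ → ℝ with g ≤ V_LJ(|x|)
off 0 and g(0) = −2 Σ_{k≥1} V_LJ(ak) for some a > 0 (then necessarily a = a* = (ζ(12)/ζ(6))^{1/6}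
and −g(0)/2 = e₁* = −ζ(6)²/(12ζ(12)) = min over periodic configurations of the line; candidate: the
Cohn–Kumar band-limited Hermite interpolant of V(a*·), numerically verified by the predecessor).
[difficulty: M] (why it might fail: Only numerics so far and the margins are thin where it matters
(V − h = 4.7e-3 at x = 1.05a*; ĥ ~ 2.96(1−t)³ at the band edge, ĥ ~ 3.84t² at 0): a certified
evaluation could still find a sign change, and the CK candidate is not unique in d = 1, so its
failure would not settle the litmus.) [CohnKumar2006, VentevogelNijboer1979, Ventevogel1978,
GardnerRadin1979, NijboerRuijgrok1985, BlancLewin2015]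
#4 CertificateRigidity3 (crux) — R₃ (card M4; re-files item 3958): any tight zero-pressure pair
certificate (g, P) for V_LJ in ℝ³ forces positional crystallization: along ground states Σ_{i<j}(V −
g_sym)(xᵢ − xⱼ) = o(N) (pair distances pinned to the contact set {g = V}) and (1/N)Σ_{i,j} g(xᵢ −
xⱼ) → 0 (structure factor pinned to {ĝ = 0}, which sees stacking order through the diffuse rods),
whence local convergence along subsequences, up to translations, to a non-zero periodic point
measure (CKMRV §uniqueness / Lev–Olevskii-type rigidity of measures with uniformly discrete support
and spectrum). [deps: MagicFunctionLJ3] [difficulty: L] (why it might fail: A tight g may be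
DEGENERATE (contact set {g=V} or zero set {ĝ=0} not uniformly discrete — Sütő-type band-limited
examples), leaving stacking-disordered or incommensurate near-minimisers unpunished; Lev–Olevskii
rigidity needs uniformly discrete support AND spectrum.) [LevOlevskii2014, CohnEtAl2019,
SutoPRL2005, BlancLewin2015, GardnerRadin1979]
#5 E8Rung (crux) — d = 8 RUNG (card M3; re-files item 3957): for the Mie potential V₁₂(r) = r⁻²⁴/24
− r⁻¹²/12 on ℝ⁸ (exponents > 8 so lattice sums converge; well depth 1/24 at r = 1) a continuous
positive-definite minorant g exists whose zero-pressure bound is attained by a periodic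
configuration (expected: E₈ at its equilibrium scale s*; the candidate is forced by CKMRV Thm
1.7/1.9, eq. (1.5): g = Σ_n p(√(2n)) aₙ + p′(√(2n)) bₙ with p = V₁₂(s*·), automatically ∫g = 0 by
stationarity in the scale). Tree: e8Configuration, Poisson over Λ₈ (proved);
CKMRV2022_interpolationFormula / _interpolationIso (named facts, not imported here). [difficulty:
open-problem] (why it might fail: The CKMRV candidate is the ONLY radial-Schwartz tight function
(Thm 1.9); for the signed Bernstein measure of r⁻²⁴/24 − r⁻¹²/12, p − g ≥ 0 between E₈ shells or ĝ ≥
0 near the first dual shell can fail; E₈ for LJ-type exponents is open even among lattices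
(BeterminPetrache2019: large exponents).) [CohnEtAl2019, Viazovska2017, BeterminPetrache2019,
CohnKumar2006]
#9 FiniteBochnerBound3 (support) — the finite zero-pressure bound (Fisher–Ruelle positive-type
estimate, Cohn–Kumar Prop. 9.3 with no density term; re-files item 3959): for every
positive-definite g with g ≤ V_LJ(|x|) off 0 in ℝ³ and every injective N-point configuration,
Σ_{i<j} V_LJ ≥ −N g(0)/2 (take c ≡ 1 in the quadratic form; injectivity gives xᵢ − xⱼ ≠ 0; the
symmetrisation g(x) + g(−x) ≤ 2V handles non-even g). [difficulty: provable-now] [Ruelle1969,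
CohnKumar2006]
#9 PeriodicBochnerBound3 (support) — the periodic zero-pressure bound (re-files item 3960): for such
g and every periodic configuration Q of ℝ³, −g(0)/2 ≤ e_LJ(Q) (finite blocks Q ∩ B_R as injective
configurations + FiniteBochnerBound3 + the r⁻⁶ summability
PeriodicConfiguration.summable_lennardJones_dist_three with boundary/tail o(R³); equivalently
Cohn–Kumar Prop. 9.3 at zero pressure — no Poisson summation needed). [difficulty: M]
[CohnKumar2006, BlancLewin2015]
#9 CrysEnergyUpper (support) — trial-state upper bound (shared item 0629, same signature): limsup
E(N)/N ≤ ⨅ over periodic configurations Q of e_LJ(Q) (finite blocks of Q as trial states, boundary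
O(N^{2/3}), r⁻⁶ tail summable; limsup is the limit e∞ of BlancLewin2015_8_holds; E(N+1) ≤ E(N)
handles N between block sizes; `le_ciInf` needs no BddBelow). [difficulty: M] [BlancLewin2015,
Theil2006]
#9 CertificateEnergetics3 (support) — glue of the energetic half (NEW; makes `closes` pure logic):
FiniteBochnerBound3 → PeriodicBochnerBound3 → CrysEnergyUpper → MagicFunctionLJ3 →
HasPeriodicGroundStateEnergy lennardJones 3. Proof (sorry-free in the planner's Sketch.lean,
attached as evidence): P from X₃ is least by PeriodicBochnerBound3; BlancLewin2015_8_holds gives e∞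
= lim E(N)/N; e(P) ≤ E(N)/N for N ≥ 1 by FiniteBochnerBound3 + le_ciInf (nonempty_injective_config),
so e(P) ≤ e∞; e∞ = limsup ≤ ⨅ ≤ e(P) by CrysEnergyUpper and ciInf_le; hence E(N)/N → e(P).
[difficulty: provable-now] [BlancLewin2015, Ruelle1969]

TWO-LAYER PLAN. Foreseen glued splits (k ≤ 3, depth 1; none filed now): LineLitmus ⇐
LineCandidateMinorant (h_CK ≤
V(a*·) off 0: certified series evaluation + node / endpoint / infinity asymptotics) →
LineCandidateFourierPositive (ĥ_CK ≥ 0 on [0,1]) → LineLitmus (glue: CK identities h(k) = V(a*k),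
supp ĥ ⊆ [−1,1], Bochner for band-limited ĥ ≥ 0, Σ kV′(a*k) = 0). MagicFunctionLJ3 ⇐ LpBracket3
(certified primal/dual bracket of the zero-pressure LP value λ₃ against |e(hcp)|) → explicit
construction. CertificateRigidity3 ⇐ SlacknessPinning (excess energy = contact defect + spectral
defect, both o(N)) → BraggRigidity (uniformly discrete support and spectrum ⇒ periodic limit) →
CertificateRigidity3. E8Rung ⇐ E8CandidateMinorant → E8CandidateFourierPositive → E8Rung (glue:
CKMRV Thm 1.7 as hypothesis, Poisson over s*Λ₈, ĝ(0) = 0). PeriodicBochnerBound3 ⇐ block counting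
lemma for periodic configurations (points in B_R = ρ|B_R| + O(R²)) → tail estimate.

KILL CRITERIA. MagicFunctionLJ3 refuted — one explicit positive-definite phantom, e.g. a Li-type
Dirac comb ν ≥ 0
on ℤ_m³, ν̂ ≥ 0, ν(0) = 1, grid (c/m)ℤ³, with ½Σ_{n≠0} ν(n̄)V_LJ((c/m)|n|) < e(hcp) = −0.7176 (card
phantom-pair-measures-lp-gap is set up to produce and certify it; my own kit jobs j003580/j003583
run the same LP numerically) — closes the route `refuted:MagicFunctionLJ3`; the certified gap
becomes the barrier fact LennardJones_twoPointNotSharp3D and redirects three-cone-certificate /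
frustration-range-lp-hierarchy to k ≥ 3 point levels; LineLitmus and E8Rung survive as shared
statements (ladder harvest). CertificateRigidity3 refuted (a degenerate tight certificate) ⇒ restate
with non-degeneracy (uniformly discrete contact and spectral sets) — a misstated-type repair, not a
kill. E8Rung refuted (the unique CKMRV candidate changes sign) ⇒ "interpolation gives LJ-type at
zero pressure" is false above d = 1: informative, not load-bearing. LineLitmus refuted by a
certified 1-D gap would contradict the predecessor's numerics — recheck, then treat the whole ladder
as dead. CrysPeriodicMinAttained (0627) refuted elsewhere kills conjunct (i) and with it every
positive route including this one.

NOT DECOMPOSED YET. The identification P = relaxed hcp inside the existential (and P = E₈, P = a*ℤ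
on the rungs);
interval-arithmetic constants for the d = 1 certificate; the d = 2 rung (triangular lattice optimal
for (12,6) among ALL periodic configurations of ℝ² — Bétermin 2023 covers Bravais lattices only; no
interpolation basis, numerics first); the Leech rung and the exponent family (2q, q), q > 8, in d =
8; the precise form of BraggRigidity (Lev–Olevskii versus the CKMRV §6 uniqueness argument) and
whether R₃ needs a non-degeneracy hypothesis; any k-point (k ≥ 3) strengthening of the certificate
(other cards: three-cone-certificate, frustration-range-lp-hierarchy,
flatley-theil-conjecture-two-sphere-sdp). Proofs of the CKMRV named facts are Literature business
(RadialSchwartzInterpolation*.lean).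

CHEAPEST FALSIFIER. The zero-pressure PHANTOM LP for V_LJ in ℝ³ (weak duality, Li2022 Thm 2 / tree
discreteDualBound_le): minimise ½Σ_{n≠0} ν(n̄) V((c/m)|n|) over ν ≥ 0 on ℤ_m³ with ν(0) = 1, ν̂ ≥ 0,
scanning the period c; any value below e(hcp) = −0.7176 kills MagicFunctionLJ3 (decision rule of the
predecessor's refuter review: gap > 5e-4 stable under grid refinement ⇒ numerically false; gap → 0 ⇒
alive). Run by me this session: kit jobs j003580 (d = 1 calibration against e₁* = −0.0862277 + d = 3
at m = 24, 32, hyperoctahedral symmetry reduction, fcc on-grid check) and j003583 (m = 48); script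
phantomlp/main.py in the planner folder; queued at filing — results will be attached to
MagicFunctionLJ3 as evidence. Already known (predecessor, pure-python certified-free numerics): in d
= 1 the Cohn–Kumar candidate for V(a*·) passes both sign checks (min ĥ = +9e-23 at t = 1, V − h ≥ 0
with double zeros at the nodes and (V − h)″(k) > 0 for k = 1..40), controls f = x⁻¹² sharp (CK
theorem) and a = 1.01a* infeasible (ĥ(0) = −0.113) as the zero-pressure identity predicts.

NUMBERS. d = 1: a* = (ζ(12)/ζ(6))^{1/6} = 0.997179; e₁* = Σ_{k≥1}V(a*k) = −ζ(6)²/(12ζ(12)) =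
−0.0862277; h(0)
= 0.1724554 = −2e₁*; ĥ(0) = −2Σ_k kV′(a*k)·a* = 0; ĥ ≈ 3.84t² at 0 and ≈ 2.96(1−t)³ at the band
edge; binding primal margin V − h = 4.7e-3 at x = 1.05a*. d = 3 (V = r⁻¹²/12 − r⁻⁶/6 =
Blanc–Lewin/12): e(fcc) = −L₆²/(24L₁₂) = −0.71752 (L₆ = 14.4539, L₁₂ = 12.1319, a_fcc =
(L₁₂/L₆)^{1/6} = 0.9712), e(hcp) = −0.71759 (L₆ = 14.4549, L₁₂ = 12.1323; relaxing c/a changes it by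
< 1e-5, kit j003580 prints the value); rigorous stability bracket 0.7175 ≤ B_LJ ≤ 14.316/12 = 1.193
(Yuhjtman2015 Thm 9, DelimaProcacciYuhjtman2015 §5.2); packing analogue: two-point bound 0.18398 vs
δ₃ = 0.17678 (Li2022, 4.1 % gap); kissing analogue: LP bound 13.16 vs 12. d = 8: Λ₈ even unimodular,
min norm √2, pair distances √(2n) (tree E8Configuration); CKMRV nodes √(2n), n ≥ 1. Items at open: 9
(4 cruxes, 4 supports, 1 assembly).

DEFINITION REQUESTS. None needed to type the items (positive-definiteness is inlined as finite real
quadratic forms;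
PeriodicConfiguration, energyPerParticle, interactionEnergy, IsCrystallizing,
HasPeriodicGroundStateEnergy, lennardJones are the Statement's own vocabulary). Literature already
vendored for the rungs since the predecessor's requests: e8Configuration + Poisson over Λ₈ (proved),
CKMRV Thm 1.7/1.9 as named facts (Literature.Analysis.Fourier.CKMRV2022_interpolationFormula /
CKMRV2022_interpolationIso) — a prover of E8Rung may only take them once PROVED, which is why E8Rung
is ranked last and marked open-problem. Wanted as a cite fact for refuters: none (weak duality for
Dirac combs is the proved tree lemma discreteDualBound_le pattern of CohnElkiesNotSharp3DProofs).

Novelty: Searches (2026-08-15, this session): lit search --hybrid "linear programming bound Lennard-Jones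
ground state energy positive definite" (12 docs, vector leg; only Ruelle1969 p. 39 relevant);
crossref "Bétermin Petrache optimal lattices non-completely monotone" (15 rows:
doi:10.1007/s13324-019-00299-6 = BeterminPetrache2019, doi:10.1007/s13324-017-0205-5); crossref
"realizability of point processes Kuna Lebowitz Speer pair correlation" (8 rows:
doi:10.1007/s10955-007-9393-y, doi:10.1214/10-aap703, doi:10.1021/jp0478155 — the phantom side of
the LP is exactly the pair statistics obeying only the two classical necessary realizability
conditions g₂ ≥ 0, S ≥ 0); lit galaxy search --star all "lower bound ground state energy
Lennard-Jones positive definite function" / "stability constant of the Lennard-Jones" (0 rows) and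
--star pdf "linear programming bounds for energy" (2 rows: CKMRV arXiv:1902.05438, BDHSS spherical
codes); openalex/arXiv rate-limited (HTTP 429 / 0 rows); searchd down part of the session (rc 75).
Carried from the predecessor and the refuter audits of the same day: lit frontier
AtomisticToContinuum --since 2020 (30 rows; arXiv:2407.20762, 2604.19239 real-space, no LP); lit
bridges --cross any (30 rows, none on energy LP); crossref Ventevogel/Nijboer (Ventevogel1978,
VentevogelNijboer1979, NijboerRuijgrok1985); zbMATH (0 rows); refuter-12 / R6 novelty audits
(Fisher–Ruelle 1966, Ruelle1969 Prop. 3.2.7 = the bound; Yuhjtman2015 / DelimaProcacciYuhjtman2015 =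
explici  [refs: 10.1007/s13324-019-00299-6, 10.1007/s13324-017-0205-5, 10.1007/s10955-007-9393-y, 10.1214/10-aap703, 10.1021/jp0478155, 1902.05438, 2407.20762, doi:10.1007/s13324-019-00299-6, doi:10.1007/s13324-017-0205-5, doi:10.1007/s10955-007-9393-y, doi:10.1214/10-aap703, doi:10.1021/jp0478155, Ruelle1969, BeterminPetrache2019, Ventevogel1978, VentevogelNijboer1979, NijboerRuijgrok1985, Yuhjtman2015, DelimaPr]

Barriers (technique_class: two-point-fourier-lp zero-pressure interpolation-basis): - technique_class: two-point-fourier-lp zero-pressure interpolation-basis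
- Literature.Barriers.AtomisticToContinuum.Li2022_cohnElkies3D: APPLIES by analogy to
MagicFunctionLJ3 (same technique class, d = 3) but, per its own audit, decides nothing for the
(12,6) energy at zero pressure; the bet is declared weak in d = 3 and the refutation is cheap and
already running (phantom LP) — that is why the crux is ranked 2; it does not touch LineLitmus /
E8Rung (d = 1, 8 are the sharp dimensions).
- Literature.Barriers.AtomisticToContinuum.NoUniversallyOptimalLattice3D: not engaged — one
potential at its own equilibrium scale, no universal optimality claimed; in d = 8 universal
optimality holds and is shown insufficient (fixed density, CM only), which is why E8Rung is a crux
and not a citation.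
- Literature.Barriers.AtomisticToContinuum.SutoDegenerateGroundStates: the degenerate face of
Fourier certificates (h = φ band-limited, continuum of ground states); it is exactly the failure
mode named for CertificateRigidity3, which must exclude it (a tight g for V_LJ is expected to have
isolated double zeros of V − g on P's distance set and of ĝ on P's Bragg set).
- Literature.Barriers.AtomisticToContinuum.HcpNotBravais: the d = 3 certificate must be tight on a
lattice-plus-motif set (extinctions in the Bragg set); the bounds (FiniteBochnerBound3,
PeriodicBochnerBound3) hold for all periodic configurations, so only the CONSTRUCTION of g is
affected — absent in d = 1, 8 where the minimisers are

Novelty grade: new-combination — ROUTE REVIEW (refuter rreview-0815T18-20): SURVIVES STRUCTURALLY, bet conceded weak. Conforming re-open of retired ZeroPressureMagicLadder (items 3955–3961 moot, none refuted). closes honest: Crystallization = ⟨CertificateEnergetics3 FB PB Upper X₃, R₃ g P …⟩; LineLitmus (d=1) and E8Rung (d=8, other (refuter refuter-rreview-0815T18-20-0, 2026-08-15T19:32:06Z; prior: arXiv:1902.05438 CKMRV, CohnKumar2006 §9 Prop 9.3, Ruelle1969 Prop 3.2.7, arXiv:2206.09876 Li2022, arXiv:0812.3390 Hopkins–Stillinger–Torquato,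 Yuhjtman2015 / DelimaProcacciYuhjtman2015)

History (route lifecycle, newest last):
- 2026-08-22T23:23:36Z · DORMANT — reconciler: no traction for 5.7 d (last activity item-evidence-added at 2026-08-17T04:47:41Z); parked, not closed — `ledger route dormant route-AtomisticToConti (operator:999:3282626)

sub-problem: Crystallization · status: dormant · opened planner-plancard-AtomisticToContinuum-Crystal-dc42983b-g2-0 2026-08-15T18:50:16Z · rev 1 · ledger route-AtomisticToContinuum-ZeroPressureMagicFunction
GENERATED by the gate from the ledger (D-0016/17). Provers cite these decls: `theorem foo : Summit.AtomisticToContinuum.Crystallization.Theses.ZeroPressureMagicFunction.<Decl> := …` in Summits/AtomisticToContinuum/Crystallization/Theorems/<Name>.lean.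
-/

namespace Summit.AtomisticToContinuum.Crystallization.Theses.ZeroPressureMagicFunction

open scoped BigOperators Topology Manifold Classical MeasureTheory ProbabilityTheory Matrix InnerProductSpace ComplexConjugate ContinuousMap
open Filter Set Function TopologicalSpace MeasureTheory

attribute [summit_statement] _root_.Crystallization

/-- item stmt-AtomisticToContinuum-12146 · crux · rank 2 · open · by planner
why it might fail: Two-point LPs are not sharp in d=3 for packing (Li2022: 0.18398 > 0.17678) nor kissing (LP 13.16 > 12): a PD phantom pair measure with ~13 'neighbours' in the well may beat hcp's 12; one Li-type Dirac comb with ½∫V dν < e(hcp) refutes it (kit j003580/j003583 running).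
sources: Li2022, CohnKumar2006, CohnLaatSalmon2022, Ruelle1969, Yuhjtman2015, DelimaProcacciYuhjtman2015
[crux] X₃ — there is a continuous positive-definite g : ℝ³ → ℝ (all finite real quadratic forms Σ
cᵢcⱼ g(xᵢ − xⱼ) ≥ 0) with g(x) ≤ V_LJ(|x|) for x ≠ 0 whose zero-pressure bound −g(0)/2 is attained
by a periodic configuration P (card M-assembly; expected P = relaxed hcp, e(P) = −L₆²/(24L₁₂) ≈
−0.7176; re-files item 3955). [difficulty: open-problem] -/
@[route_item "route-AtomisticToContinuum-ZeroPressureMagicFunction", crux]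
def MagicFunctionLJ3 : Prop :=
  ∃ g : EuclideanSpace ℝ (Fin 3) → ℝ, Continuous g ∧ (∀ (n : ℕ) (x : Fin n → EuclideanSpace ℝ (Fin 3)) (c : Fin n → ℝ), 0 ≤ ∑ i, ∑ j, c i * c j * g (x i - x j)) ∧ (∀ x : EuclideanSpace ℝ (Fin 3), x ≠ 0 → g x ≤ Literature.MathematicalPhysics.StatisticalMechanics.lennardJones ‖x‖) ∧ ∃ P : Literature.MathematicalPhysics.StatisticalMechanics.PeriodicConfiguration 3, P.energyPerParticle Literature.MathematicalPhysics.StatisticalMechanics.lennardJones = -(g 0) / 2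

/-- item stmt-AtomisticToContinuum-12147 · crux · rank 3 · open · by planner
why it might fail: Only numerics so far and the margins are thin where it matters (V − h = 4.7e-3 at x = 1.05a*; ĥ ~ 2.96(1−t)³ at the band edge, ĥ ~ 3.84t² at 0): a certified evaluation could still find a sign change, and the CK candidate is not unique in d = 1, so its failure would not settle the litmus.
sources: CohnKumar2006, VentevogelNijboer1979, Ventevogel1978, GardnerRadin1979, NijboerRuijgrok1985, BlancLewin2015
[crux] d = 1 LITMUS (card M2; re-files item 3956): the zero-pressure two-point bound is sharp for
the Lennard-Jones chain — a continuous positive-definite g : ℝ → ℝ with g ≤ V_LJ(|x|) off 0 and g(0)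
= −2 Σ_{k≥1} V_LJ(ak) for some a > 0 (then necessarily a = a* = (ζ(12)/ζ(6))^{1/6} and −g(0)/2 = e₁*
= −ζ(6)²/(12ζ(12)) = min over periodic configurations of the line; candidate: the Cohn–Kumar
band-limited Hermite interpolant of V(a*·), numerically verified by the predecessor). [difficulty:
M] -/
@[route_item "route-AtomisticToContinuum-ZeroPressureMagicFunction", crux]
def LineLitmus : Prop :=
  ∃ (g : ℝ → ℝ) (a : ℝ), 0 < a ∧ Continuous g ∧ (∀ (n : ℕ) (x : Fin n → ℝ) (c : Fin n → ℝ), 0 ≤ ∑ i, ∑ j, c i * c j * g (x i - x j)) ∧ (∀ x : ℝ, x ≠ 0 → g x ≤ Literature.MathematicalPhysics.StatisticalMechanics.lennardJones |x|) ∧ g 0 = -2 * ∑' k : ℕ, Literature.MathematicalPhysics.StatisticalMechanics.lennardJones (a * ((k : ℝ) + 1))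

/-- item stmt-AtomisticToContinuum-12148 · crux · rank 4 · open · by planner
why it might fail: A tight g may be DEGENERATE (contact set {g=V} or zero set {ĝ=0} not uniformly discrete — Sütő-type band-limited examples), leaving stacking-disordered or incommensurate near-minimisers unpunished; Lev–Olevskii rigidity needs uniformly discrete support AND spectrum.
sources: LevOlevskii2014, CohnEtAl2019, SutoPRL2005, BlancLewin2015, GardnerRadin1979
[crux] R₃ (card M4; re-files item 3958): any tight zero-pressure pair certificate (g, P) for V_LJ in
ℝ³ forces positional crystallization: along ground states Σ_{i<j}(V − g_sym)(xᵢ − xⱼ) = o(N) (pair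
distances pinned to the contact set {g = V}) and (1/N)Σ_{i,j} g(xᵢ − xⱼ) → 0 (structure factor
pinned to {ĝ = 0}, which sees stacking order through the diffuse rods), whence local convergence
along subsequences, up to translations, to a non-zero periodic point measure (CKMRV §uniqueness /
Lev–Olevskii-type rigidity of measures with uniformly discrete support and spectrum). [deps:
MagicFunctionLJ3] [difficulty: L] -/
@[route_item "route-AtomisticToContinuum-ZeroPressureMagicFunction", crux]
def CertificateRigidity3 : Prop :=
  ∀ (g : EuclideanSpace ℝ (Fin 3) → ℝ) (P : Literature.MathematicalPhysics.StatisticalMechanics.PeriodicConfiguration 3), Continuous g → (∀ (n : ℕ) (x : Fin n → EuclideanSpace ℝ (Fin 3)) (c : Fin n → ℝ), 0 ≤ ∑ i, ∑ j, c i * c j * g (x i - x j)) → (∀ x : EuclideanSpace ℝ (Fin 3), x ≠ 0 → g x ≤ Literature.MathematicalPhysics.StatisticalMechanics.lennardJones ‖x‖) → P.energyPerParticle Literature.MathematicalPhysics.StatisticalMechanics.lennardJones = -(g 0) / 2 → Literature.MathematicalPhysics.StatisticalMechanics.IsCrystallizing Literature.MathematicalPhysics.StatisticalMechanics.lennardJones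 3

/-- item stmt-AtomisticToContinuum-12149 · crux · rank 5 · open · by planner
why it might fail: The CKMRV candidate is the ONLY radial-Schwartz tight function (Thm 1.9); for the signed Bernstein measure of r⁻²⁴/24 − r⁻¹²/12, p − g ≥ 0 between E₈ shells or ĝ ≥ 0 near the first dual shell can fail; E₈ for LJ-type exponents is open even among lattices (BeterminPetrache2019: large exponents).
sources: CohnEtAl2019, Viazovska2017, BeterminPetrache2019, CohnKumar2006
[crux] d = 8 RUNG (card M3; re-files item 3957): for the Mie potential V₁₂(r) = r⁻²⁴/24 − r⁻¹²/12 on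
ℝ⁸ (exponents > 8 so lattice sums converge; well depth 1/24 at r = 1) a continuous positive-definite
minorant g exists whose zero-pressure bound is attained by a periodic configuration (expected: E₈ at
its equilibrium scale s*; the candidate is forced by CKMRV Thm 1.7/1.9, eq. (1.5): g = Σ_n p(√(2n))
aₙ + p′(√(2n)) bₙ with p = V₁₂(s*·), automatically ∫g = 0 by stationarity in the scale). Tree:
e8Configuration, Poisson over Λ₈ (proved); CKMRV2022_interpolationFormula / _interpolationIso (named
facts, not imported here). [difficulty: open-problem] -/
@[route_item "route-AtomisticToContinuum-ZeroPressureMagicFunction", crux]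
def E8Rung : Prop :=
  ∃ g : EuclideanSpace ℝ (Fin 8) → ℝ, Continuous g ∧ (∀ (n : ℕ) (x : Fin n → EuclideanSpace ℝ (Fin 8)) (c : Fin n → ℝ), 0 ≤ ∑ i, ∑ j, c i * c j * g (x i - x j)) ∧ (∀ x : EuclideanSpace ℝ (Fin 8), x ≠ 0 → g x ≤ (1 / 24) * (‖x‖⁻¹) ^ 24 - (1 / 12) * (‖x‖⁻¹) ^ 12) ∧ ∃ P : Literature.MathematicalPhysics.StatisticalMechanics.PeriodicConfiguration 8, P.energyPerParticle (fun r : ℝ => (1 / 24) * (r⁻¹) ^ 24 - (1 / 12) * (r⁻¹) ^ 12) = -(g 0) / 2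

/-- item stmt-AtomisticToContinuum-11865 · support · rank 9 · closed · proved by Summit.AtomisticToContinuum.Crystallization.Theorems.crysEnergyUpper_proof @ b1410290bb74 (prover) · by planner
sources: BlancLewin2015, Theil2006
[support] trial-state upper bound limsup E(N)/N ≤ ⨅ over periodic Q of e_LJ(Q) (shared item 0629,
same signature: finite blocks of Q plus far-away extras, boundary O(N^{2/3}), r⁻⁶ tail summable in d
= 3; le_ciInf needs only Nonempty; coboundedness of the limsup from BlancLewin2015_8_holds /
lennardJones_stable_holds, both proved in tree). [difficulty: provable-now] -/
@[route_item "route-AtomisticToContinuum-ZeroPressureMagicFunction", crux]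
def CrysEnergyUpper : Prop :=
  Filter.limsup (fun N : ℕ => Literature.MathematicalPhysics.StatisticalMechanics.groundStateEnergy Literature.MathematicalPhysics.StatisticalMechanics.lennardJones 3 N / N) Filter.atTop ≤ ⨅ Q : Literature.MathematicalPhysics.StatisticalMechanics.PeriodicConfiguration 3, Q.energyPerParticle Literature.MathematicalPhysics.StatisticalMechanics.lennardJones

/-- item stmt-AtomisticToContinuum-12150 · support · rank 9 · open · by planner
sources: Ruelle1969, CohnKumar2006
[support] the finite zero-pressure bound (Fisher–Ruelle positive-type estimate, Cohn–Kumar Prop. 9.3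
with no density term; re-files item 3959): for every positive-definite g with g ≤ V_LJ(|x|) off 0 in
ℝ³ and every injective N-point configuration, Σ_{i<j} V_LJ ≥ −N g(0)/2 (take c ≡ 1 in the quadratic
form; injectivity gives xᵢ − xⱼ ≠ 0; the symmetrisation g(x) + g(−x) ≤ 2V handles non-even g).
[difficulty: provable-now] -/
@[route_item "route-AtomisticToContinuum-ZeroPressureMagicFunction", crux]
def FiniteBochnerBound3 : Prop :=
  ∀ (g : EuclideanSpace ℝ (Fin 3) → ℝ), (∀ (n : ℕ) (x : Fin n → EuclideanSpace ℝ (Fin 3)) (c : Fin n → ℝ), 0 ≤ ∑ i, ∑ j, c i * c j * g (x i - x j)) → (∀ x : EuclideanSpace ℝ (Fin 3), x ≠ 0 → g x ≤ Literature.MathematicalPhysics.StatisticalMechanics.lennardJones ‖x‖) → ∀ (N : ℕ) (x : Fin N → EuclideanSpace ℝ (Fin 3)), Function.Injective x → -(g 0) / 2 * (N : ℝ) ≤ Literature.MathematicalPhysics.StatisticalMechanics.interactionEnergy Literature.MathematicalPhysics.StatisticalMechanics.lennardJones x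

/-- item stmt-AtomisticToContinuum-12151 · support · rank 9 · open · by planner
sources: CohnKumar2006, BlancLewin2015
[support] the periodic zero-pressure bound (re-files item 3960): for such g and every periodic
configuration Q of ℝ³, −g(0)/2 ≤ e_LJ(Q) (finite blocks Q ∩ B_R as injective configurations +
FiniteBochnerBound3 + the r⁻⁶ summability PeriodicConfiguration.summable_lennardJones_dist_three
with boundary/tail o(R³); equivalently Cohn–Kumar Prop. 9.3 at zero pressure — no Poisson summation
needed). [difficulty: M] -/
@[route_item "route-AtomisticToContinuum-ZeroPressureMagicFunction", crux]
def PeriodicBochnerBound3 : Prop :=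
  ∀ (g : EuclideanSpace ℝ (Fin 3) → ℝ), (∀ (n : ℕ) (x : Fin n → EuclideanSpace ℝ (Fin 3)) (c : Fin n → ℝ), 0 ≤ ∑ i, ∑ j, c i * c j * g (x i - x j)) → (∀ x : EuclideanSpace ℝ (Fin 3), x ≠ 0 → g x ≤ Literature.MathematicalPhysics.StatisticalMechanics.lennardJones ‖x‖) → ∀ Q : Literature.MathematicalPhysics.StatisticalMechanics.PeriodicConfiguration 3, -(g 0) / 2 ≤ Q.energyPerParticle Literature.MathematicalPhysics.StatisticalMechanics.lennardJones

/-- item stmt-AtomisticToContinuum-12152 · support · rank 9 · open · by planner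
sources: BlancLewin2015, Ruelle1969
[support] glue of the energetic half (NEW; makes `closes` pure logic): FiniteBochnerBound3 →
PeriodicBochnerBound3 → CrysEnergyUpper → MagicFunctionLJ3 → HasPeriodicGroundStateEnergy
lennardJones 3. Proof (sorry-free in the planner's Sketch.lean, attached as evidence): P from X₃ is
least by PeriodicBochnerBound3; BlancLewin2015_8_holds gives e∞ = lim E(N)/N; e(P) ≤ E(N)/N for N ≥
1 by FiniteBochnerBound3 + le_ciInf (nonempty_injective_config), so e(P) ≤ e∞; e∞ = limsup ≤ ⨅ ≤
e(P) by CrysEnergyUpper and ciInf_le; hence E(N)/N → e(P). [difficulty: provable-now] -/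
@[route_item "route-AtomisticToContinuum-ZeroPressureMagicFunction", crux]
def CertificateEnergetics3 : Prop :=
  FiniteBochnerBound3 → PeriodicBochnerBound3 → CrysEnergyUpper → MagicFunctionLJ3 → Literature.MathematicalPhysics.StatisticalMechanics.HasPeriodicGroundStateEnergy Literature.MathematicalPhysics.StatisticalMechanics.lennardJones 3

/-- item stmt-AtomisticToContinuum-12153 · assembly · rank 1 · open · by planner
sources: BlancLewin2015, CohnKumar2006
[assembly] MagicFunctionLJ3 → CertificateRigidity3 → FiniteBochnerBound3 → PeriodicBochnerBound3 →
CrysEnergyUpper → CertificateEnergetics3 → Crystallization (the load-bearing chain; LineLitmus and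
E8Rung are deliberately absent). -/
@[route_item "route-AtomisticToContinuum-ZeroPressureMagicFunction", crux]
def Assembly : Prop :=
  MagicFunctionLJ3 → CertificateRigidity3 → FiniteBochnerBound3 → PeriodicBochnerBound3 → CrysEnergyUpper → CertificateEnergetics3 → _root_.Crystallization

/-! D-0027 §2.1 — DECIDING THEOREM (planner-authored via `route open/edit --closes-file`; by planner-plancard-AtomisticToContinuum-Crystal-dc42983b-g2-0 2026-08-15T18:50:18Z):
its hypotheses are this route's items and its conclusion the sub-problem Statement (glue_lint), and it elaborates with this file. -/

@[closes "route-AtomisticToContinuum-ZeroPressureMagicFunction"] theorem closes (h₁ : MagicFunctionLJ3) (h₂ : LineLitmus) (h₃ : CertificateRigidity3) (h₄ : E8Rung)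
    (h₅ : FiniteBochnerBound3) (h₆ : PeriodicBochnerBound3) (h₇ : CrysEnergyUpper)
    (h₈ : CertificateEnergetics3) (h₉ : Assembly) : _root_.Crystallization := by
  obtain ⟨g, hc, hpd, hmin, P, hP⟩ := h₁
  exact ⟨h₈ h₅ h₆ h₇ ⟨g, hc, hpd, hmin, P, hP⟩, h₃ g P hc hpd hmin hP⟩

end Summit.AtomisticToContinuum.Crystallization.Theses.ZeroPressureMagicFunction
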